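import Mathlib

/-!
# PneNP / BruckRyserSos — traces of powers as closed walks; `tr (A q(A)²)` through the spectrum

Route `PneNP/BruckRyserSos`, crux stmt-PneNP-16761 (`SosBlindPlanes`); generic real matrix facts
used by file `…Spectral`:

* `pow_apply_eq_sum_walks`, `trace_pow_succ` — entries and traces of powers of a matrix as sums
  over walks / closed walks (so that traces of powers of an invariant moment matrix are template
  sums, file `…TemplateSum`);
* `trace_mul_aeval_sq` — for a real symmetric `A` with eigenvalues `λ_i`,
  `tr (A q(A) q(A)) = Σ_i λ_i q(λ_i)²` (spectral theorem), `trace_mul_aeval_sq_nonneg` — it is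
  `≥ 0` when `A ⪰ 0`;
* `posSemidef_of_trace_nonneg` — conversely, if `A` satisfies a nonzero polynomial of degree `≤ K`
  and `tr (A q(A) q(A)) ≥ 0` for all `q` of degree `< K`, then `A ⪰ 0` (Lagrange interpolation on
  the at most `K` distinct eigenvalues).

References: R. A. Horn, C. R. Johnson, *Matrix Analysis* (2nd ed.), Thm. 4.1.5; folklore.
-/

set_option linter.dupNamespace false -- `Summit.PneNP.PneNP.…`: summit = sub-problem name (D-0017 single-conjunct layout)

noncomputable section

namespace Summit.PneNP.PneNP.Theorems.SosBlindPlanes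

open Finset Function Matrix Polynomial

/-! ### Closed walks: entries and traces of powers -/

section Walks

variable {ι : Type*} [Fintype ι] [DecidableEq ι] (A : Matrix ι ι ℝ)

/-- The weight of a walk `z₀ → z₁ → ⋯ → z_k`. [folklore] -/
def walkWeight {k : ℕ} (z : Fin (k + 1) → ι) : ℝ :=
  ∏ i : Fin k, A (z i.castSucc) (z i.succ)

omit [Fintype ι] [DecidableEq ι] in
/-- The weight of a walk extended by one step. [folklore] -/
theorem walkWeight_snoc {k : ℕ} (z : Fin (k + 1) → ι) (c : ι) :
    walkWeight A (Fin.snoc z c : Fin (k + 2) → ι) = walkWeight A z * A (z (Fin.last k)) c := by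
  rw [walkWeight, Fin.prod_univ_castSucc, walkWeight]
  congr 1
  · refine prod_congr rfl fun i _ => ?_
    have h1 : (Fin.snoc z c : Fin (k + 2) → ι) i.castSucc.castSucc = z i.castSucc :=
      Fin.snoc_castSucc (α := fun _ => ι) _ _ _
    have h2 : (Fin.snoc z c : Fin (k + 2) → ι) i.castSucc.succ = z i.succ := by
      rw [Fin.succ_castSucc]; exact Fin.snoc_castSucc (α := fun _ => ι) _ _ _
    rw [h1, h2]
  · have h1 : (Fin.snoc z c : Fin (k + 2) → ι) (Fin.last k).castSucc = z (Fin.last k) :=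
      Fin.snoc_castSucc (α := fun _ => ι) _ _ _
    have h2 : (Fin.snoc z c : Fin (k + 2) → ι) (Fin.last k).succ = c := by
      rw [Fin.succ_last]; exact Fin.snoc_last _ _
    rw [h1, h2]

/-- Entries of powers as sums over walks:
`(A^k) a b = Σ_z [z₀ = a, z_k = b] Π_i A(z_i, z_{i+1})`. [folklore] -/
theorem pow_apply_eq_sum_walks (k : ℕ) (a b : ι) :
    (A ^ k) a b = ∑ z : Fin (k + 1) → ι,
      if z 0 = a ∧ z (Fin.last k) = b then walkWeight A z else 0 := by
  induction k generalizing b with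
  | zero =>
    rw [pow_zero, Matrix.one_apply]
    have hsum : ∑ z : Fin 1 → ι, (if z 0 = a ∧ z (Fin.last 0) = b then walkWeight A z else 0) =
        ∑ c : ι, if c = a ∧ c = b then (1 : ℝ) else 0 := by
      rw [← Equiv.sum_comp (Equiv.funUnique (Fin 1) ι).symm]
      refine sum_congr rfl fun c _ => ?_
      have h1 : (Equiv.funUnique (Fin 1) ι).symm c 0 = c := rfl
      have hw : walkWeight A ((Equiv.funUnique (Fin 1) ι).symm c) = 1 := by simp [walkWeight]
      rw [Fin.last_zero, h1, hw]
    rw [hsum]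
    by_cases hab : a = b
    · subst hab
      simp
    · rw [if_neg hab]
      refine (Finset.sum_eq_zero fun c _ => ?_).symm
      rw [if_neg]
      rintro ⟨rfl, rfl⟩
      exact hab rfl
  | succ k ih =>
    rw [pow_succ, Matrix.mul_apply]
    -- both sides equal `Σ_z [z₀ = a] (walk weight) · A (z_k) b`
    have hL : ∑ c, (A ^ k) a c * A c b = ∑ z : Fin (k + 1) → ι,
        if z 0 = a then walkWeight A z * A (z (Fin.last k)) b else 0 := by
      simp_rw [ih, sum_mul]
      rw [sum_comm]
      refine sum_congr rfl fun z _ => ?_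
      by_cases hz : z 0 = a
      · simp only [hz, true_and, ite_mul, zero_mul, if_true]
        rw [Finset.sum_ite_eq]
        simp
      · simp [hz]
    have hR : ∑ z' : Fin (k + 2) → ι,
        (if z' 0 = a ∧ z' (Fin.last (k + 1)) = b then walkWeight A z' else 0) =
        ∑ z : Fin (k + 1) → ι, if z 0 = a then walkWeight A z * A (z (Fin.last k)) b else 0 := by
      rw [← (Fin.snocEquiv fun _ : Fin (k + 2) => ι).sum_comp, Fintype.sum_prod_type, sum_comm]
      refine sum_congr rfl fun z _ => ?_
      have hz0 : ∀ c : ι, (Fin.snoc z c : Fin (k + 2) → ι) 0 = z 0 := fun c => by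
        rw [← Fin.castSucc_zero]; exact Fin.snoc_castSucc (α := fun _ => ι) _ _ _
      have hzl : ∀ c : ι, (Fin.snoc z c : Fin (k + 2) → ι) (Fin.last (k + 1)) = c := fun c =>
        Fin.snoc_last _ _
      have he : ∀ c : ι, (Fin.snocEquiv fun _ : Fin (k + 2) => ι) (c, z) =
          (Fin.snoc z c : Fin (k + 2) → ι) := fun c => rfl
      simp only [he, hz0, hzl, walkWeight_snoc]
      by_cases hz : z 0 = a
      · simp only [hz, true_and]
        rw [Finset.sum_ite_eq']
        simp
      · simp [hz]
    rw [hL, hR]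

/-- **Traces of powers as sums over closed walks.**
`tr (A^(k+1)) = Σ_{z : Fin (k+2) → ι} [z₀ = z_{k+1}] Π_{i ≤ k} A(z_i, z_{i+1})`. [folklore] -/
theorem trace_pow_succ (k : ℕ) :
    (A ^ (k + 1)).trace = ∑ z : Fin (k + 2) → ι,
      if z 0 = z (Fin.last (k + 1)) then walkWeight A z else 0 := by
  rw [Matrix.trace]
  simp only [Matrix.diag, pow_apply_eq_sum_walks]
  rw [sum_comm]
  refine sum_congr rfl fun z _ => ?_
  by_cases hz : z 0 = z (Fin.last (k + 1))
  · rw [if_pos hz]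
    rw [Finset.sum_eq_single (z 0)]
    · rw [if_pos ⟨rfl, hz.symm⟩]
    · intro c _ hc
      rw [if_neg]
      rintro ⟨h1, _⟩
      exact hc h1.symm
    · intro h; exact absurd (mem_univ _) h
  · rw [if_neg hz]
    refine sum_eq_zero fun c _ => ?_
    rw [if_neg]
    rintro ⟨rfl, h2⟩
    exact hz h2.symm

end Walks

/-! ### Polynomials in a symmetric matrix: spectral computation of `tr (A q(A)²)` -/

section SpectralTrace

variable {ι : Type*} [Fintype ι] [DecidableEq ι]

/-- Polynomials act on eigenvectors through their values at the eigenvalue. [folklore] -/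
theorem aeval_mulVec_of_eigen {A : Matrix ι ι ℝ} {u : ι → ℝ} {t : ℝ} (hu : A *ᵥ u = t • u)
    (g : ℝ[X]) : (aeval A g) *ᵥ u = (g.eval t) • u := by
  induction g using Polynomial.induction_on' with
  | add p q hp hq => rw [map_add, add_mulVec, hp, hq, eval_add, add_smul]
  | monomial n r =>
    rw [aeval_monomial, eval_monomial, Algebra.algebraMap_eq_smul_one, smul_mul_assoc, one_mul,
      smul_mulVec]
    have : ∀ m : ℕ, (A ^ m) *ᵥ u = t ^ m • u := by
      intro m
      induction m with
      | zero => simp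
      | succ m ihm =>
        rw [pow_succ, ← mulVec_mulVec, hu, mulVec_smul, ihm, smul_smul, mul_comm, ← pow_succ]
    rw [this, smul_smul]

/-- Polynomials in a diagonal matrix. [folklore] -/
theorem aeval_diagonal (d : ι → ℝ) (g : ℝ[X]) :
    aeval (diagonal d) g = diagonal fun i => g.eval (d i) := by
  induction g using Polynomial.induction_on' with
  | add p q hp hq =>
    rw [map_add, hp, hq, diagonal_add]
    simp only [eval_add]
  | monomial n r =>
    rw [aeval_monomial, Algebra.algebraMap_eq_smul_one, smul_mul_assoc, one_mul, diagonal_pow,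
      ← diagonal_smul]
    congr 1
    funext i
    simp [eval_monomial]

/-- Conjugating by a unitary commutes with polynomial evaluation. [folklore] -/
theorem aeval_conj_unitary {A U D : Matrix ι ι ℝ} (hU : star U * U = 1) (hU' : U * star U = 1)
    (hA : A = U * D * star U) (g : ℝ[X]) : aeval A g = U * aeval D g * star U := by
  induction g using Polynomial.induction_on' with
  | add p q hp hq => rw [map_add, map_add, hp, hq, Matrix.mul_add, Matrix.add_mul]
  | monomial n r =>
    simp only [aeval_monomial, Algebra.algebraMap_eq_smul_one, smul_mul_assoc, one_mul,
      Matrix.mul_smul]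
    congr 1
    induction n with
    | zero => rw [pow_zero, pow_zero, Matrix.mul_one, hU']
    | succ n ihn =>
      rw [pow_succ, ihn, hA, pow_succ]
      simp only [Matrix.mul_assoc]
      congr 2
      rw [← Matrix.mul_assoc (star U) U, hU, Matrix.one_mul]

/-- **Spectral computation.** For a real symmetric matrix with eigenvalues `λ_i`:
`tr (A q(A) q(A)) = Σ_i λ_i q(λ_i)²`. [Horn–Johnson, Thm. 4.1.5] [folklore] -/
theorem trace_mul_aeval_sq {A : Matrix ι ι ℝ} (hA : A.IsHermitian) (q : ℝ[X]) :
    (A * aeval A q * aeval A q).trace =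
      ∑ i, hA.eigenvalues i * (q.eval (hA.eigenvalues i)) ^ 2 := by
  set U : Matrix ι ι ℝ := (hA.eigenvectorUnitary : Matrix ι ι ℝ) with hUdef
  set D : Matrix ι ι ℝ := diagonal hA.eigenvalues with hDdef
  have hU : star U * U = 1 := Unitary.coe_star_mul_self hA.eigenvectorUnitary
  have hU' : U * star U = 1 := Unitary.coe_mul_star_self hA.eigenvectorUnitary
  have hAeq : A = U * D * star U := by
    have h := hA.spectral_theorem
    rw [Unitary.conjStarAlgAut_apply] at h
    have hD' : diagonal (RCLike.ofReal ∘ hA.eigenvalues : ι → ℝ) = D := by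
      rw [hDdef]; congr 1
    rw [hD'] at h
    exact h
  have hq := aeval_conj_unitary hU hU' hAeq q
  have hprod : A * aeval A q * aeval A q = U * (D * aeval D q * aeval D q) * star U := by
    rw [hq, hAeq]
    simp only [Matrix.mul_assoc]
    congr 2
    rw [← Matrix.mul_assoc (star U) U, hU, Matrix.one_mul]
    congr 1
    rw [← Matrix.mul_assoc (star U) U, hU, Matrix.one_mul]
  rw [hprod, Matrix.trace_mul_cycle, hU, Matrix.one_mul, hDdef, aeval_diagonal,
    diagonal_mul_diagonal, diagonal_mul_diagonal, Matrix.trace_diagonal]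
  refine sum_congr rfl fun i _ => ?_
  ring

/-- A polynomial in a real symmetric matrix is symmetric. [folklore] -/
theorem conjTranspose_aeval {A : Matrix ι ι ℝ} (hA : A.IsHermitian) (g : ℝ[X]) :
    (aeval A g)ᴴ = aeval A g := by
  induction g using Polynomial.induction_on' with
  | add p q hp hq => rw [map_add, conjTranspose_add, hp, hq]
  | monomial n r =>
    rw [aeval_monomial, Algebra.algebraMap_eq_smul_one, smul_mul_assoc, one_mul,
      conjTranspose_smul, conjTranspose_pow, hA.eq, star_trivial]

/-- For a positive semidefinite real matrix, `tr (A q(A) q(A)) ≥ 0` for every real polynomial.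
[folklore] -/
theorem trace_mul_aeval_sq_nonneg {A : Matrix ι ι ℝ} (hA : A.PosSemidef) (q : ℝ[X]) :
    0 ≤ (A * aeval A q * aeval A q).trace := by
  rw [Matrix.trace_mul_cycle]
  have h := hA.conjTranspose_mul_mul_same (aeval A q)
  rw [conjTranspose_aeval hA.1] at h
  exact h.trace_nonneg

/-- **Positive semidefiniteness from traces.** If a real symmetric matrix satisfies a nonzero
polynomial of degree `≤ K` and `tr (A q(A) q(A)) ≥ 0` for all `q` of degree `< K`, then
`A ⪰ 0` (Lagrange interpolation on the at most `K` distinct eigenvalues). [folklore] -/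
theorem posSemidef_of_trace_nonneg {A : Matrix ι ι ℝ} (hA : A.IsHermitian) {K : ℕ}
    (hg : ∃ g : ℝ[X], g ≠ 0 ∧ g.natDegree ≤ K ∧ aeval A g = 0)
    (hpos : ∀ q : ℝ[X], q.natDegree < K → 0 ≤ (A * aeval A q * aeval A q).trace) :
    A.PosSemidef := by
  classical
  obtain ⟨g, hg0, hgK, hgA⟩ := hg
  set lam := hA.eigenvalues with hlam
  -- every eigenvalue is a root of `g`
  have hroot : ∀ i, g.IsRoot (lam i) := by
    intro i
    have hu : A *ᵥ (hA.eigenvectorBasis i).ofLp = lam i • (hA.eigenvectorBasis i).ofLp :=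
      hA.mulVec_eigenvectorBasis i
    have h := aeval_mulVec_of_eigen hu g
    rw [hgA, zero_mulVec] at h
    have hne : (hA.eigenvectorBasis i).ofLp ≠ 0 := by
      intro h0
      apply hA.eigenvectorBasis.orthonormal.ne_zero i
      exact (WithLp.ofLp_eq_zero 2).1 h0
    rcases smul_eq_zero.1 h.symm with h1 | h1
    · exact h1
    · exact absurd h1 hne
  set Λ : Finset ℝ := univ.image lam with hΛ
  have hΛcard : Λ.card ≤ K := by
    have hsub : Λ ⊆ g.roots.toFinset := by
      intro x hx
      obtain ⟨i, _, rfl⟩ := mem_image.1 hx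
      exact Multiset.mem_toFinset.2 ((mem_roots hg0).2 (hroot i))
    exact (card_le_card hsub).trans ((Multiset.toFinset_card_le _).trans
      ((card_roots' g).trans hgK))
  -- each eigenvalue is nonnegative, by Lagrange interpolation
  rw [hA.posSemidef_iff_eigenvalues_nonneg]
  intro i₀
  have hi₀ : lam i₀ ∈ Λ := mem_image_of_mem _ (mem_univ _)
  set q := Lagrange.basis Λ (id : ℝ → ℝ) (lam i₀) with hq
  have hinj : Set.InjOn (id : ℝ → ℝ) Λ := Set.injOn_id _
  have hqdeg : q.natDegree < K := by
    have hdeg := Lagrange.degree_basis hinj hi₀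
    have hpos' : 0 < Λ.card := card_pos.2 ⟨_, hi₀⟩
    have : q.natDegree = Λ.card - 1 := natDegree_eq_of_degree_eq_some hdeg
    omega
  have h := hpos q hqdeg
  rw [trace_mul_aeval_sq hA] at h
  have hval : ∀ i, q.eval (lam i) = if lam i = lam i₀ then 1 else 0 := by
    intro i
    split_ifs with hi
    · rw [hi]; exact Lagrange.eval_basis_self hinj hi₀
    · exact Lagrange.eval_basis_of_ne (s := Λ) (v := (id : ℝ → ℝ)) (Ne.symm hi)
        (mem_image_of_mem _ (mem_univ _))
  have hsum : ∑ i, lam i * (q.eval (lam i)) ^ 2 =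
      ((univ.filter fun i => lam i = lam i₀).card : ℝ) * lam i₀ := by
    rw [← sum_filter_add_sum_filter_not univ (fun i => lam i = lam i₀)]
    have h1 : ∑ i ∈ univ.filter (fun i => lam i = lam i₀), lam i * (q.eval (lam i)) ^ 2 =
        ∑ _i ∈ univ.filter (fun i => lam i = lam i₀), lam i₀ := by
      refine sum_congr rfl fun i hi => ?_
      have hi' := (mem_filter.1 hi).2
      rw [hval i, if_pos hi', hi']; ring
    have h2 : ∑ i ∈ univ.filter (fun i => ¬ lam i = lam i₀), lam i * (q.eval (lam i)) ^ 2 = 0 := by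
      refine sum_eq_zero fun i hi => ?_
      have hi' := (mem_filter.1 hi).2
      rw [hval i, if_neg hi']; ring
    rw [h1, h2, add_zero, sum_const, nsmul_eq_mul]
  rw [hsum] at h
  have hc : (0 : ℝ) < (univ.filter fun i => lam i = lam i₀).card := by
    exact_mod_cast card_pos.2 ⟨i₀, by simp⟩
  exact nonneg_of_mul_nonneg_right h hc

end SpectralTrace

end Summit.PneNP.PneNP.Theorems.SosBlindPlanes
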